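import Literature.Computability.MetaComplexity.EFLayout
import HarnessLib

/-!
MAINTENANCE 2026-08-20 (ops-buildfix lane): `wireVal_congr`, `wireVal_embed`, `wireVal_layout` are renamed with a trailing prime in this file — the unprimed
fully-qualified names are ALSO declared in `EFSemantics.lean`, and two modules declaring one name cannot be co-imported (this broke the
`Literature` root aggregate). Only the names changed; statements and proofs are otherwise byte-identical.

# Semantics of layouts: the wire values of an embedded piece

Compositionality of the wire-value semantics (`Netlist.wireVal`) of templates
(`EFNetlist.lean`) with respect to composition (`Netlist.embed`, `Netlist.layout`,
`EFLayout.lean`):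
* `Netlist.wireVal_congr'` / `wireVal_append_left` — the value of wire `k` only depends on the
  gates `≤ k`;
* `Netlist.wireVal_embed'` — the wires of an embedded well-formed sub-template carry the values
  of the sub-template on the values its wiring reads;
* `Netlist.wireVal_layout'` — the same for piece `k` of a layout of well-wired pieces;
* `Netlist.assign_pieceOcc` — under the assignment of an instance of a layout, the gate
  variables of the occurrence of piece `k` carry the wire values of its template on the values
  of its own input variables.
These transport the arithmetic correctness of the basic templates to their occurrences inside
composite kits (the covering property of the translations).

## Sources

* H. Vollmer, *Introduction to Circuit Complexity* (Springer 1999), §1.2, Def. 1.6–1.7.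
-/

namespace Literature.Computability.MetaComplexity

open _root_.Computability Complexity Complexity.PropForm

namespace Netlist

/-! ### Dependence on a prefix -/

/-- The value of wire `k` only depends on the gates `≤ k`. [cite: Vollmer1999, Def. 1.7] -/
theorem wireVal_congr' {t₁ t₂ : Template} (inp : ℕ → Bool) {k : ℕ} (h : ∀ j ≤ k, t₁[j]? = t₂[j]?) :
    wireVal t₁ inp k = wireVal t₂ inp k := by
  induction k using Nat.strong_induction_on with
  | _ k ih =>
    rw [wireVal, wireVal, h k le_rfl]
    cases t₂[k]? with
    | none => rfl
    | some g =>
      have hw : (fun j => if j < k then wireVal t₁ inp j else false) = fun j => if j < k then wireVal t₂ inp j else false := by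
        funext j; split_ifs with hj
        · exact ih j hj fun j' hj' => h j' (by omega)
        · rfl
      simp only [hw]

/-- Appending gates does not change the earlier wires. [cite: Vollmer1999, Def. 1.7] -/
theorem wireVal_append_left (t r : Template) (inp : ℕ → Bool) {k : ℕ} (hk : k < t.length) :
    wireVal (t ++ r) inp k = wireVal t inp k :=
  wireVal_congr' inp fun j hj => by rw [List.getElem?_append_left (by omega)]

/-! ### Embedded sub-templates -/

/-- The input values an embedded sub-template reads: layout inputs or earlier wires of the prefix. [folklore] -/
def subInp (inp : ℕ → Bool) (pre : Template) (w : ℕ → ℕ ⊕ ℕ) (i : ℕ) : Bool := refVal inp (wireVal pre inp) (w i)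

/-- **The wires of an embedded well-formed sub-template** (placed after `pre`, wired by `w` to
layout inputs and wires of `pre`, followed by anything) carry the values of the sub-template on
`subInp`. [cite: Vollmer1999, Def. 1.7] -/
theorem wireVal_embed' {pre sub rest : Template} {nInSub : ℕ} (hwf : sub.WF nInSub) {w : ℕ → ℕ ⊕ ℕ}
    (hw : ∀ i < nInSub, ∀ g, w i = Sum.inr g → g < pre.length) (inp : ℕ → Bool) :
    ∀ {j : ℕ}, j < sub.length → wireVal (pre ++ embed sub w pre.length ++ rest) inp (pre.length + j) = wireVal sub (subInp inp pre w) j := by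
  intro j hj
  induction j using Nat.strong_induction_on with
  | _ j ih =>
    set big : Template := pre ++ embed sub w pre.length ++ rest with hbig
    -- the gate of the big template at `|pre| + j`
    have hlen : pre.length + j < (pre ++ embed sub w pre.length).length := by simp; omega
    have hg : big[pre.length + j]? = some ⟨(sub[j]).kind, (sub[j]).args.map (remap w pre.length)⟩ := by
      rw [hbig, List.getElem?_append_left hlen, List.getElem?_append_right (by omega), Nat.add_sub_cancel_left,
        List.getElem?_eq_getElem (by simpa using hj), getElem_embed sub w pre.length (by simpa using hj)]
    -- unfold both sides once
    rw [wireVal, hg, wireVal, List.getElem?_eq_getElem hj]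
    dsimp only
    -- the earlier wires of the big template: the prefix, and the embedded gates below `j`
    have hpre : ∀ g < pre.length, wireVal big inp g = wireVal pre inp g := fun g hg => by
      rw [hbig, List.append_assoc]; exact wireVal_append_left pre _ inp hg
    have harg : ∀ i, argVal inp (fun j' => if j' < pre.length + j then wireVal big inp j' else false) ((sub[j]).args.map (remap w pre.length)) i =
        argVal (subInp inp pre w) (fun j' => if j' < j then wireVal sub (subInp inp pre w) j' else false) (sub[j]).args i := by
      intro i
      unfold argVal
      rw [List.getElem?_map]
      cases ha : (sub[j]).args[i]? with
      | none => rfl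
      | some a =>
        obtain ⟨h₁, h₂⟩ := (hwf j hj).2 a (List.mem_of_getElem? ha)
        simp only [Option.map_some]
        cases a with
        | inl i' =>
          -- a sub-template input: wired to a layout input or a wire of the prefix
          have hi' := h₁ i' rfl
          show refVal inp _ (remap w pre.length (Sum.inl i')) = refVal (subInp inp pre w) _ (Sum.inl i')
          simp only [remap, refVal, subInp]
          cases hwi : w i' with
          | inl a => rfl
          | inr g =>
            have hg' := hw i' hi' g hwi
            simp only [show g < pre.length + j by omega, if_true, hpre g hg']
        | inr j' =>
          have hj' := h₂ j' rfl
          show refVal inp _ (remap w pre.length (Sum.inr j')) = refVal (subInp inp pre w) _ (Sum.inr j')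
          simp only [remap, refVal, show pre.length + j' < pre.length + j by omega, hj', if_true]
          exact ih j' hj' (by omega)
    rw [harg, harg, harg]

/-! ### Layouts -/

/-- The input values piece `k` of a layout reads. [folklore] -/
def pieceInp (P : ℕ → Piece) (inp : ℕ → Bool) (k i : ℕ) : Bool := refVal inp (wireVal (layout P k) inp) ((P k).wire i)

/-- **The wires of piece `k < N` of a layout of well-wired pieces** carry the values of its
template on `pieceInp`. [cite: Vollmer1999, Def. 1.7] -/
theorem wireVal_layout' (P : ℕ → Piece) {nIn N k : ℕ} (hok : ∀ k < N, Piece.OK P nIn k) (hk : k < N) (inp : ℕ → Bool) {j : ℕ} (hj : j < (P k).T.length) :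
    wireVal (layout P N) inp (offset P k + j) = wireVal (P k).T (pieceInp P inp k) j := by
  obtain ⟨rest, hrest⟩ := layout_prefix P (Nat.succ_le_of_lt hk)
  rw [hrest, layout_succ]
  have := wireVal_embed' (pre := layout P k) (rest := rest) (hok k hk).1 (fun i hi g hg => ((hok k hk).2 i hi).2 g hg) inp hj
  rw [length_layout] at this
  exact this

/-- Earlier wires of a layout are wires of the shorter layouts. [folklore] -/
theorem wireVal_layout_mono (P : ℕ → Piece) {k N : ℕ} (hk : k ≤ N) (inp : ℕ → Bool) {g : ℕ} (hg : g < offset P k) :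
    wireVal (layout P N) inp g = wireVal (layout P k) inp g := by
  obtain ⟨rest, hrest⟩ := layout_prefix P hk
  rw [hrest]; exact wireVal_append_left _ _ inp (by rwa [length_layout])

/-! ### Occurrences under the assignment of an instance -/

/-- **Under the assignment of an instance of a layout, the gates of the occurrence of piece `k`
carry the wire values of its template on the values of its own inputs.** [cite: Vollmer1999, Def. 1.7] -/
theorem assign_pieceOcc (P : ℕ → Piece) {nIn N k : ℕ} (hok : ∀ k < N, Piece.OK P nIn k) (hk : k < N) (I : Inst)
    (hin : ∀ i < nIn, I.inputs.getD i 0 < I.base) (σ₀ : ℕ → Bool) {j : ℕ} (hj : j < (P k).T.length) :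
    I.assign (layout P N) σ₀ ((pieceOcc I P k).base + j) =
      wireVal (P k).T (fun i => I.assign (layout P N) σ₀ ((pieceOcc I P k).inp i)) j := by
  have hoff : offset P k + j < (layout P N).length := by rw [length_layout]; exact offset_add_lt_offset P hk hj
  have e1 : (pieceOcc I P k).base + j = I.wire (offset P k + j) := by simp [pieceOcc, Inst.wire, Nat.add_assoc]
  rw [e1, I.assign_wire _ σ₀ hoff, wireVal_layout' P hok hk _ hj]
  -- the two input valuations agree on the inputs `< nIn(k)` the template reads
  refine wireVal_inp_congr (hok k hk).1 fun i hi => ?_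
  unfold pieceInp
  rcases ((hok k hk).2 i hi) with ⟨h₁, h₂⟩
  cases hwi : (P k).wire i with
  | inl a =>
    have ha := hin a (h₁ a hwi)
    simp only [refVal, inp_pieceOcc, hwi, Inst.ref]
    rw [I.assign_of_not_mem _ _ (by omega)]
  | inr g =>
    have hg := h₂ g hwi
    simp only [refVal, inp_pieceOcc, hwi, Inst.ref]
    rw [I.assign_wire _ σ₀ (by rw [length_layout]; exact hg.trans_le (offset_le_of_le P hk.le)), wireVal_layout_mono P hk.le _ hg]
where
  /-- the wire values only depend on the inputs the (well-formed) template reads -/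
  wireVal_inp_congr {t : Template} {nI : ℕ} (hwf : t.WF nI) {inp₁ inp₂ : ℕ → Bool} (h : ∀ i < nI, inp₁ i = inp₂ i) :
      ∀ {j : ℕ}, wireVal t inp₁ j = wireVal t inp₂ j := by
    intro j
    induction j using Nat.strong_induction_on with
    | _ j ih =>
      rw [wireVal, wireVal]
      cases hg : t[j]? with
      | none => rfl
      | some g =>
        have hjt : j < t.length := by
          by_contra hc; rw [List.getElem?_eq_none (by omega)] at hg; cases hg
        have hgj : t[j] = g := by rw [List.getElem?_eq_getElem hjt] at hg; exact Option.some.inj hg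
        dsimp only
        have harg : ∀ i, argVal inp₁ (fun j' => if j' < j then wireVal t inp₁ j' else false) g.args i =
            argVal inp₂ (fun j' => if j' < j then wireVal t inp₂ j' else false) g.args i := by
          intro i; unfold argVal
          cases ha : g.args[i]? with
          | none => rfl
          | some a =>
            obtain ⟨h₁, -⟩ := (hwf j hjt).2 a (by rw [hgj]; exact List.mem_of_getElem? ha)
            cases a with
            | inl i' => exact h i' (h₁ i' rfl)
            | inr j' =>
              simp only [refVal]
              by_cases hj' : j' < j
              · rw [if_pos hj', if_pos hj']; exact ih j' hj'
              · rw [if_neg hj', if_neg hj']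
        rw [harg, harg, harg]

end Netlist

end Literature.Computability.MetaComplexity
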